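import Summits.ABC.IUTFork.Joshi.ATS4Differents
import Literature.IUT.LogVolume.Corollary22TorsionCoordinates
import HarnessLib

/-!
# [J-IV] Lemma 4.1.2 DISCHARGED on the tree's theta-field model:
# `Gal(F/F_tpd) ↪ ℤ/2 × GL₂(𝔽₂) × GL₂(𝔽₃) × GL₂(𝔽₅)` for `F = F_tpd(√−1, E_λ[3·5])`

Record file of the abc-iut cell, branch E «type Joshi's construction, test vs S» (rung LADDER-ABC:A2.E; seat abc-iut-E-t26,
slot T-26 fallback (1) «DERIVABLE rows of a landed Joshi file» on its own `Joshi/ATS4Differents.lean`, node J4:Lem4.1.2).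
TAKES NO SIDE on [IUTchIII] Cor. 3.12, on Joshi's claims, or on Mochizuki's reports on them; typed ≠ proved ≠ endorsed.
Source: K. Joshi, *Construction of Arithmetic Teichmuller Spaces IV*, arXiv:2403.10430v2 (UNREFEREED, bib `Joshi2024ATS4`),
Lemma 4.1.2, p.38 l.25–29 of the cell render `HOME/lit/renders/Joshi-arxiv-2403.10430/`: «The extension `L/L_mod` is a
composite extension of Galois extensions, it is Galois with `Gal(L/L_mod) ↪ ℤ/2 × GL₂(𝔽₂) × GL₂(𝔽₃) × GL₂(𝔽₅)`»; printed
proof: «By §4.1.1, §4.1.2, `L/L_mod` is a composite of Galois extension and the assertions follows from [Lang, 2002, Chap VI,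
Theorem 1.14]». The same sentence on the Mochizuki side: [IUTchIV] Thm. 1.10, proof, Step (ii), p.24: «`Gal(F/F_tpd) ↪
GL₂(𝔽₃) × GL₂(𝔽₅) × ℤ/2ℤ`» (in the tree so far only as the degree divisibility `Cor22.IsThetaField.finrank_dvd`,
`[F : F_tpd] ∣ 46080`).

## What is proved (PROOF-ONLY; no new definition, no claim asserted)

The companion file types Lemma 4.1.2 as the claim-`Prop` `ATS4.GaloisGroupEmbeds L_mod L` = «`L/L_mod` Galois ∧ ∃ injective
group hom `Gal(L/L_mod) →* ℤ/2 × GL₂(𝔽₂) × GL₂(𝔽₃) × GL₂(𝔽₅)`». Here it is PROVED on the one model of Joshi's `L` the tree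
carries: `L_tpd = F_tpd`, the field of a point `λ ∈ U_X` of the `λ`-line (tree `NFPoint` with `P.InU`), and
`L = F = F_tpd(√−1, E_λ[3·5])`, the field of [IUTchIV] Cor. 2.2 (ii) p.42 / Joshi §4.1.2 (9) «`L = L_tpd(√−1, C_{L_tpd}[3·5])`»
(tree predicate `Cor22.IsThetaField P F`, abc-iut-S-d2; inhabited for every `λ ∈ U_X`, `Cor22.exists_isThetaField`), RELATIVE
TO `L_tpd` (the level at which the tree pins the field; the factor `GL₂(𝔽₂)` of the printed target, which accounts for
`L_tpd = L_mod(C[2])` over `L_mod`, is then simply not used):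

* `galoisGroupEmbeds_of_isThetaField` — `ATS4.GaloisGroupEmbeds P.F F` for EVERY theta-field `F` of `P` (an abstract
  `F_tpd`-algebra; the proof embeds it into `Ω = F̄_tpd`). Route (Silverman *AEC* III.§7 / VIII.§1; Serre 1972 §4.1): the
  homomorphism `Φ = (χ_i, ρ̄₃, ρ̄₅) : Gal(Ω/F_tpd) → ℤ/2 × GL₂(𝔽₃) × GL₂(𝔽₅)` (`χ_i` the sign on `i = √−1`; `ρ̄_p` the mod-`p`
  representation on `E_λ[p](Ω) ≅ 𝔽_p²`, framed by the tree's `exists_addEquiv_mulEquiv_addAut_GL2`) has kernel EXACTLY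
  `Gal(Ω/φ(F))` (`⊇`: fixing `i` and `E_λ[15](Ω)` fixes the generators of `φ(F)`; `⊆`: fixing `φ(F)` fixes `i ∈ φ(F)` and —
  transporting `IsThetaField.torsion_rational` from `F̄` to `Ω` along an `F`-isomorphism `Ω ≃ F̄`, the tree's [GenEll] Thm. 3.8
  transport pattern run backwards — every `15`-torsion point of `E_λ(Ω)`); so `Φ` descends along the surjective restriction
  `Gal(Ω/F_tpd) → Gal(φ(F)/F_tpd)` to an INJECTIVE homomorphism, carried back to `Gal(F/F_tpd)` along `F ≃ φ(F)`.
* `exists_embedding_galoisGroup_thetaField` — the [IUTchIV] Step (ii) form without the idle factor: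
  `Gal(F/F_tpd) ↪ ℤ/2 × GL₂(𝔽₃) × GL₂(𝔽₅)` (from which `finrank_dvd` follows again: `natCard_aut_thetaField_dvd`).

NOT here: the `L_mod`-level statement (Joshi's `L_mod = F_mod = ℚ(j(λ))`; the tree pins the field over `F_tpd ⊇ F_mod` and
records Galois-over-`F_mod` only for initial Θ-data, `InitialThetaData.isGalois_fieldOfModuli_K`); any `Cor312*`/`Thm311*` (R14).
-/

noncomputable section

open scoped Classical

open NumberField Field IntermediateField WeierstrassCurve
open Literature.IUT.LogVolume Literature.IUT.LogVolume.Cor22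
open Literature.NumberTheory.DiophantineGeometry.GenEll Literature.NumberTheory.EllipticCurves

namespace Summit.ABC.IUTFork.Joshi.ATS4

/-! ## 1. Two generic group-theoretic tools -/
section SignCharacter

variable {G Ω : Type*} [Group G] [Field Ω] [MulSemiringAction G Ω]

/-- A field automorphism moves a square root `i` of `−1` to `± i`. [folklore] -/
theorem smul_sqrt_neg_one_eq_or (σ : G) {i : Ω} (hi : i ^ 2 = -1) : σ • i = i ∨ σ • i = -i := by
  apply sq_eq_sq_iff_eq_or_eq_neg.1
  rw [← smul_pow', hi, smul_neg, smul_one]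

/-- **The sign character of `√−1`**: for a group acting on a field of characteristic `≠ 2` by ring automorphisms and
`i² = −1`, there is a homomorphism `χ : G →* ℤ/2` (written multiplicatively) with `χ(σ) = 1 ↔ σ(i) = i` — the action
on `{±i}`. (Stated as an existence so that this file declares no data.) [folklore] -/
theorem exists_signChar {i : Ω} (hi : i ^ 2 = -1) (h2 : (2 : Ω) ≠ 0) :
    ∃ χ : G →* Multiplicative (ZMod 2), ∀ σ, χ σ = 1 ↔ σ • i = i := by
  have hii : i ≠ -i := fun h => by
    have h0 : (2 : Ω) * i = 0 := by rw [two_mul]; nth_rw 2 [h]; exact add_neg_cancel i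
    rcases mul_eq_zero.1 h0 with h0 | h0
    · exact h2 h0
    · rw [h0] at hi; norm_num at hi
  have hne : (Multiplicative.ofAdd (1 : ZMod 2)) ≠ 1 := by decide
  have h11 : Multiplicative.ofAdd (1 : ZMod 2) * Multiplicative.ofAdd (1 : ZMod 2) = 1 := by decide
  let f : G → Multiplicative (ZMod 2) := fun σ => if σ • i = i then 1 else Multiplicative.ofAdd (1 : ZMod 2)
  have hf : ∀ σ, f σ = if σ • i = i then 1 else Multiplicative.ofAdd (1 : ZMod 2) := fun _ => rfl
  -- multiplicativity by cases on the signs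
  have hmul : ∀ σ τ, f (σ * τ) = f σ * f τ := fun σ τ => by
    rw [hf, hf, hf, mul_smul]
    rcases smul_sqrt_neg_one_eq_or τ hi with hτ | hτ <;> rcases smul_sqrt_neg_one_eq_or σ hi with hσ | hσ <;>
      simp [hτ, hσ, smul_neg, hii.symm, h11]
  refine ⟨{ toFun := f, map_one' := by rw [hf, if_pos (one_smul G i)], map_mul' := hmul }, fun σ => ?_⟩
  change f σ = 1 ↔ σ • i = i
  rw [hf]
  by_cases h : σ • i = i
  · simp [h]
  · simp [h, hne]

end SignCharacter

section Frame

variable {K : Type} [Field K] [NumberField K] (W : WeierstrassCurve K) [W.IsElliptic] (p : ℕ) [hp : Fact p.Prime]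

/-- **`ρ̄_{E,p} : Γ_K → GL₂(𝔽_p)`**: the mod-`p` representation of an elliptic curve over a number field, framed — a
homomorphism to `GL₂(𝔽_p)` with the same kernel as the tree's `galoisRepTorsion` (`E[p](K̄) ≅ 𝔽_p²` by the tree's
`card_torsionPoints_eq_sq_holds`, framed by `exists_addEquiv_mulEquiv_addAut_GL2`; Serre 1972 §4.1 "`φ_l : G → Aut(E_l) ≅
GL₂(𝔽_l)`"). [cite: Serre1972, §4.1] -/
theorem exists_galoisRep_GL2_ker_eq :
    ∃ ρ : absoluteGaloisGroup K →* GL (Fin 2) (ZMod p), ρ.ker = (W.galoisRepTorsion (p : ℤ)).ker := by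
  letI : Module (ZMod p) (geomTorsion W (p : ℤ)) := AddSubgroup.torsionBy.zmodModule
  have hpF : ((p : ℕ) : AlgebraicClosure K) ≠ 0 := by
    haveI : CharZero (AlgebraicClosure K) :=
      charZero_of_injective_algebraMap (algebraMap K (AlgebraicClosure K)).injective
    exact_mod_cast hp.out.ne_zero
  have hcard : Nat.card (geomTorsion W (p : ℤ)) = p ^ 2 := card_torsionPoints_eq_sq_holds W (AlgebraicClosure K) hpF
  obtain ⟨-, Φ, -, -, -⟩ := exists_addEquiv_mulEquiv_addAut_GL2 (ℓ := p) (geomTorsion W (p : ℤ)) hcard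
  refine ⟨Φ.toMonoidHom.comp (W.galoisRepTorsion (p : ℤ)), ?_⟩
  ext σ
  rw [MonoidHom.mem_ker, MonoidHom.mem_ker, MonoidHom.comp_apply, MulEquiv.coe_toMonoidHom, MulEquiv.map_eq_one_iff]

omit [NumberField K] [W.IsElliptic] in
/-- `σ ∈ ker ρ̄_{E,n}` iff `σ` fixes every `n`-torsion point of `E(K̄)` (unfolding of the tree's `galoisRepTorsion`).
[folklore] -/
theorem mem_ker_galoisRepTorsion_iff_forall (n : ℤ) (σ : absoluteGaloisGroup K) :
    σ ∈ (W.galoisRepTorsion n).ker ↔ ∀ Q : geomTorsion W n, σ • Q = Q := by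
  rw [MonoidHom.mem_ker]
  constructor
  · intro h Q
    have hQ := galoisRepTorsion_apply W n σ Q
    rw [h] at hQ
    exact hQ.symm
  · intro h
    refine Multiplicative.toAdd.injective (AddEquiv.ext fun Q => ?_)
    rw [galoisRepTorsion_apply, h Q]
    rfl

end Frame

/-! ## 2. The theta field: coordinates, embeddings, and the transport of `torsion_rational` -/

section ThetaField

variable {P : NFPoint} {F : Type} [Field F] [NumberField F] [Algebra P.F F]

omit [NumberField F] in
/-- The image of the coordinate set of an `F`-point under an `F_tpd`-embedding `φ : F → Ω` is the coordinate set of the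
image point. [folklore] -/
theorem pointCoords_map {Ω : Type} [Field Ω] [Algebra P.F Ω] (φ : F →ₐ[P.F] Ω)
    (T : (P.legendreCurve.baseChange F).toAffine.Point) :
    pointCoords (Affine.Point.map (W' := P.legendreCurve) φ T) = φ '' pointCoords T := by
  rcases T with _ | ⟨x, y, h⟩
  · show pointCoords (Affine.Point.zero : (P.legendreCurve.baseChange Ω).toAffine.Point) =
      φ '' pointCoords (Affine.Point.zero : (P.legendreCurve.baseChange F).toAffine.Point)
    simp [pointCoords]
  · rw [Affine.Point.map_some]
    simp only [pointCoords, Set.image_pair]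

/-- **The generators of a theta field land in `{±i} ∪ coords(E_λ[15](Ω))`**: for `F` a theta field of `P` and any
`F_tpd`-embedding `φ : F → Ω = F̄_tpd`, the image `φ(F)` is contained in `F_tpd(±i, coordinates of the 15-torsion points of
E_λ(Ω))` (`i` any square root of `−1` in `Ω`). [cite: Mochizuki2012, IUTchIV Cor. 2.2 (ii) p.42] -/
theorem fieldRange_le_adjoin_of_isThetaField (hF : IsThetaField P F)
    (φ : F →ₐ[P.F] AlgebraicClosure P.F) {i : AlgebraicClosure P.F} (hi : i ^ 2 = -1) :
    φ.fieldRange ≤ adjoin P.F (({i, -i} : Set (AlgebraicClosure P.F)) ∪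
      ⋃ T ∈ {T : geomPoints P.legendreCurve | (15 : ℤ) • T = 0}, pointCoords T) := by
  set S : Set (AlgebraicClosure P.F) := ({i, -i} : Set (AlgebraicClosure P.F)) ∪
      ⋃ T ∈ {T : geomPoints P.legendreCurve | (15 : ℤ) • T = 0}, pointCoords T with hS
  -- `φ(F) = φ(F_tpd(gens)) = F_tpd(φ(gens))`
  have hgen := hF.adjoin_eq_top
  rw [torsionCoords_eq P F] at hgen
  rw [AlgHom.fieldRange_eq_map, ← hgen, adjoin_map]
  refine adjoin.mono _ _ _ ?_
  rintro _ ⟨x, hx, rfl⟩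
  rcases hx with hx | hx
  · -- `x² = −1`, so `φ x = ± i`
    have hx' : (φ x) ^ 2 = i ^ 2 := by rw [← map_pow, hx, hi, map_neg, map_one]
    rcases sq_eq_sq_iff_eq_or_eq_neg.1 hx' with h | h
    · exact Or.inl (Or.inl h)
    · exact Or.inl (Or.inr h)
  · -- `x` is a coordinate of an `F`-rational `15`-torsion point `T`; map `T` along `φ`
    obtain ⟨T, hT, hxT⟩ := Set.mem_iUnion₂.1 hx
    have hT' : (15 : ℤ) • (Affine.Point.map (W' := P.legendreCurve) φ T : geomPoints P.legendreCurve) = 0 := by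
      rw [← map_zsmul, show (15 : ℤ) • T = 0 from hT, map_zero]
    refine Or.inr (Set.mem_iUnion₂.2 ⟨_, hT', ?_⟩)
    change φ x ∈ pointCoords (Affine.Point.map (W' := P.legendreCurve) φ T)
    rw [pointCoords_map]
    exact ⟨x, hxT, rfl⟩

/-- `i = √−1 ∈ φ(F)` for a theta field `F` (it contains a square root of `−1`, which `φ` maps to `±i`).
[cite: Mochizuki2012, IUTchIV Cor. 2.2 (ii) p.42] -/
theorem sqrt_neg_one_mem_fieldRange_of_isThetaField (hF : IsThetaField P F)
    (φ : F →ₐ[P.F] AlgebraicClosure P.F) {i : AlgebraicClosure P.F} (hi : i ^ 2 = -1) : i ∈ φ.fieldRange := by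
  obtain ⟨j, hj⟩ := hF.sqrt_neg_one
  have hj' : (φ j) ^ 2 = i ^ 2 := by rw [← map_pow, hj, hi, map_neg, map_one]
  rcases sq_eq_sq_iff_eq_or_eq_neg.1 hj' with h | h
  · exact ⟨j, h⟩
  · have : i = -φ j := by rw [h, neg_neg]
    rw [this]
    exact neg_mem ⟨j, rfl⟩

/-- **Transport of `IsThetaField.torsion_rational` to `F̄_tpd`** (the tree's [GenEll] Thm. 3.8 transport pattern,
`EllPoint.forall_smul_geomTorsion_map_eq_of_fixingSubgroup_le`, run backwards): for a theta field `F` of `P` (`λ ∈ U_X`)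
embedded by `φ` into `Ω = F̄_tpd`, every `σ ∈ Gal(Ω/F_tpd)` fixing `φ(F)` pointwise fixes every `15`-torsion point of
`E_λ(Ω)`. (Along an `F`-isomorphism `ι : Ω ≃ F̄` — `Ω` is an algebraic closure of `F` through `φ` — the element `ισι⁻¹` lies in
`Gal(F̄/F)`, which fixes `E_λ[15](F̄)` by `torsion_rational`.) [cite: SilvermanAEC2009, VIII.§1] -/
theorem smul_eq_of_mem_fixingSubgroup_fieldRange (hF : IsThetaField P F)
    (φ : F →ₐ[P.F] AlgebraicClosure P.F) {σ : absoluteGaloisGroup P.F}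
    (hσ : σ ∈ (φ.fieldRange.fixingSubgroup : Subgroup (absoluteGaloisGroup P.F)))
    (T : geomPoints P.legendreCurve) (hT : (15 : ℤ) • T = 0) : σ • T = T := by
  let Ω := AlgebraicClosure P.F
  let K' := AlgebraicClosure F
  -- `Ω` as an `F`-algebra through `φ`; it is an algebraic closure of `F`
  letI : Algebra F Ω := φ.toRingHom.toAlgebra
  haveI : IsScalarTower P.F F Ω := IsScalarTower.of_algebraMap_eq fun x => (φ.commutes x).symm
  haveI : Algebra.IsAlgebraic F Ω := Algebra.IsAlgebraic.tower_top (K := P.F) F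
  haveI : IsAlgClosure F Ω :=
    { isAlgClosed := inferInstanceAs (IsAlgClosed (AlgebraicClosure P.F))
      isAlgebraic := inferInstance }
  let ι : Ω ≃ₐ[F] K' := IsAlgClosure.equiv F Ω K'
  let ιF : Ω ≃ₐ[P.F] K' := ι.restrictScalars P.F
  -- `σ` is `F`-linear since it fixes `φ(F)`
  have hσF : ∀ x : F, (absoluteGaloisGroup.toAlgEquiv P.F σ) (algebraMap F Ω x) = algebraMap F Ω x := by
    intro x
    have hx : algebraMap F Ω x ∈ φ.fieldRange := ⟨x, rfl⟩
    exact (IntermediateField.mem_fixingSubgroup_iff _ _).1 hσ _ hx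
  let σF : Ω ≃ₐ[F] Ω :=
    { (absoluteGaloisGroup.toAlgEquiv P.F σ).toRingEquiv with commutes' := hσF }
  have hσF_apply : ∀ z : Ω, σF z = absoluteGaloisGroup.toAlgEquiv P.F σ z := fun _ => rfl
  -- its transport `σ' = ι σ ι⁻¹ ∈ Gal(F̄/F)`
  let τ : K' ≃ₐ[F] K' := (ι.symm.trans σF).trans ι
  let σ' : absoluteGaloisGroup F := (absoluteGaloisGroup.toAlgEquiv F).symm τ
  -- the curve `E_F` over `F̄` is the Legendre curve of `F_tpd` base-changed to `F̄`; transport of points along `ι`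
  have hW : thetaCurve P F = P.legendreCurve.map (algebraMap P.F F) := thetaCurve_eq_map P F
  have hrat := hF.torsion_rational
  rw [hW] at hrat
  let Tm : geomPoints P.legendreCurve →+ geomPoints (P.legendreCurve.map (algebraMap P.F F)) :=
    Affine.Point.map (W' := P.legendreCurve) (ιF : Ω →ₐ[P.F] K')
  have hTm_inj : Function.Injective Tm := Affine.Point.map_injective (W' := P.legendreCurve) (f := (ιF : Ω →ₐ[P.F] K'))
  -- `Tm T` is `15`-torsion, hence fixed by `σ'`
  have hT' : (15 : ℤ) • Tm T = 0 := by rw [← map_zsmul, hT, map_zero]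
  have hfix : σ' • Tm T = Tm T := hrat σ' (Tm T) hT'
  -- the action of `σ'` on `Tm T` is the transport of the action of `σ` on `T`
  have hact' : ∀ y : geomPoints (P.legendreCurve.map (algebraMap P.F F)), σ' • y =
      Affine.Point.map (W' := P.legendreCurve) ((τ.restrictScalars P.F : K' ≃ₐ[P.F] K') : K' →ₐ[P.F] K') y :=
    fun y => by cases y <;> rfl
  have hact : σ • T = Affine.Point.map (W' := P.legendreCurve)
      ((absoluteGaloisGroup.toAlgEquiv P.F σ : Ω ≃ₐ[P.F] Ω) : Ω →ₐ[P.F] Ω) T := by cases T <;> rfl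
  have hcomp : (ιF : Ω →ₐ[P.F] K').comp ((absoluteGaloisGroup.toAlgEquiv P.F σ : Ω ≃ₐ[P.F] Ω) : Ω →ₐ[P.F] Ω) =
      ((τ.restrictScalars P.F : K' ≃ₐ[P.F] K') : K' →ₐ[P.F] K').comp (ιF : Ω →ₐ[P.F] K') := by
    ext z
    change ι (absoluteGaloisGroup.toAlgEquiv P.F σ z) = ι (σF (ι.symm (ι z)))
    rw [AlgEquiv.symm_apply_apply, hσF_apply]
  have key : Tm (σ • T) = σ' • Tm T := by
    rw [hact', hact]
    change Affine.Point.map (W' := P.legendreCurve) (ιF : Ω →ₐ[P.F] K')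
        (Affine.Point.map (W' := P.legendreCurve)
          ((absoluteGaloisGroup.toAlgEquiv P.F σ : Ω ≃ₐ[P.F] Ω) : Ω →ₐ[P.F] Ω) T) =
      Affine.Point.map (W' := P.legendreCurve) ((τ.restrictScalars P.F : K' ≃ₐ[P.F] K') : K' →ₐ[P.F] K')
        (Affine.Point.map (W' := P.legendreCurve) (ιF : Ω →ₐ[P.F] K') T)
    rw [Affine.Point.map_map, Affine.Point.map_map, hcomp]
  exact hTm_inj (by rw [key, hfix])

/-- Hence an element of `Gal(F̄_tpd/F_tpd)` fixing `φ(F)` acts trivially on `E_λ[n](F̄_tpd)` for `n ∣ 15`, i.e. lies in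
`ker ρ̄_{E_λ,n}`. [cite: SilvermanAEC2009, VIII.§1] -/
theorem fixingSubgroup_fieldRange_le_ker (hF : IsThetaField P F)
    (φ : F →ₐ[P.F] AlgebraicClosure P.F) {n : ℕ} (hn : (n : ℤ) ∣ 15) :
    (φ.fieldRange.fixingSubgroup : Subgroup (absoluteGaloisGroup P.F)) ≤
      (P.legendreCurve.galoisRepTorsion (n : ℤ)).ker := by
  intro σ hσ
  refine (mem_ker_galoisRepTorsion_iff_forall P.legendreCurve (n : ℤ) σ).2 fun Q => ?_
  obtain ⟨m, hm⟩ := hn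
  apply Subtype.ext
  rw [AddSubgroup.torsionBy.coe_smul]
  refine smul_eq_of_mem_fixingSubgroup_fieldRange hF φ hσ (Q : geomPoints P.legendreCurve) ?_
  have hQ : (n : ℤ) • (Q : geomPoints P.legendreCurve) = 0 :=
    (Submodule.mem_torsionBy_iff (n : ℤ) (Q : geomPoints P.legendreCurve)).mp Q.2
  rw [hm, mul_comm, mul_smul, hQ, smul_zero]

/-- Conversely an element of `Gal(F̄_tpd/F_tpd)` fixing `i` and acting trivially on `E_λ[3]` and `E_λ[5]` fixes `φ(F)`
pointwise (it fixes the generators `±i` and — `E[15] = E[3] ⊕ E[5]` — all `15`-torsion coordinates).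
[cite: SilvermanAEC2009, VIII.§1] -/
theorem mem_fixingSubgroup_fieldRange_of (hF : IsThetaField P F) (φ : F →ₐ[P.F] AlgebraicClosure P.F)
    {i : AlgebraicClosure P.F} (hi : i ^ 2 = -1) {σ : absoluteGaloisGroup P.F} (hσi : σ • i = i)
    (h3 : σ ∈ (P.legendreCurve.galoisRepTorsion ((3 : ℕ) : ℤ)).ker)
    (h5 : σ ∈ (P.legendreCurve.galoisRepTorsion ((5 : ℕ) : ℤ)).ker) :
    σ ∈ (φ.fieldRange.fixingSubgroup : Subgroup (absoluteGaloisGroup P.F)) := by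
  have hle := fieldRange_le_adjoin_of_isThetaField hF φ hi
  have h3' := (mem_ker_galoisRepTorsion_iff_forall _ _ σ).1 h3
  have h5' := (mem_ker_galoisRepTorsion_iff_forall _ _ σ).1 h5
  have hS : σ ∈ (adjoin P.F (({i, -i} : Set (AlgebraicClosure P.F)) ∪
      ⋃ T ∈ {T : geomPoints P.legendreCurve | (15 : ℤ) • T = 0}, pointCoords T)).fixingSubgroup := by
    refine mem_fixingSubgroup_adjoin_of_forall_eq fun s hs => ?_
    change σ • s = s
    rcases hs with hs | hs
    · rcases hs with rfl | rfl
      · exact hσi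
      · rw [smul_neg, hσi]
    · obtain ⟨T, hT, hz⟩ := Set.mem_iUnion₂.1 hs
      exact forall_coords_of_smul_eq P σ T (smul_eq_of_fifteen σ h3' h5' T hT) s hz
  exact (IntermediateField.mem_fixingSubgroup_iff _ _).2 fun x hx =>
    (IntermediateField.mem_fixingSubgroup_iff _ _).1 hS x (hle hx)

/-! ## 3. Lemma 4.1.2 on the theta-field model -/

/-- **[IUTchIV] Thm. 1.10 Step (ii), p.24: «`Gal(F/F_tpd) ↪ GL₂(𝔽₃) × GL₂(𝔽₅) × ℤ/2ℤ`»** — for `λ ∈ U_X` and every theta field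
`F = F_tpd(√−1, E_λ[3·5])` of `P` (tree `Cor22.IsThetaField`), there is an injective group homomorphism
`Gal(F/F_tpd) →* ℤ/2 × GL₂(𝔽₃) × GL₂(𝔽₅)` (the actions on `{±√−1}`, `E_λ[3]`, `E_λ[5]`). PROVED (classical; the tree recorded
only the consequence `[F : F_tpd] ∣ 46080`). [cite: Mochizuki2012, IUTchIV Thm. 1.10 proof Step (ii) p.24] -/
theorem exists_embedding_galoisGroup_thetaField (hU : P.InU) (hF : IsThetaField P F) :
    ∃ ψ : (F ≃ₐ[P.F] F) →* Multiplicative (ZMod 2) × GL (Fin 2) (ZMod 3) × GL (Fin 2) (ZMod 5),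
      Function.Injective ψ := by
  haveI hE : P.legendreCurve.IsElliptic := P.legendreCurve_isElliptic_iff.2 hU
  haveI : Fact (Nat.Prime 3) := ⟨Nat.prime_three⟩
  haveI : Fact (Nat.Prime 5) := ⟨Nat.prime_five⟩
  haveI := hF.isGalois
  set Ω := AlgebraicClosure P.F with hΩ
  haveI : CharZero Ω := charZero_of_injective_algebraMap (algebraMap P.F Ω).injective
  -- `i = √−1 ∈ Ω`, the sign character and the two framed torsion representations
  obtain ⟨i, hi⟩ : ∃ i : Ω, i ^ 2 = -1 := IsAlgClosed.exists_pow_nat_eq (-1 : Ω) two_pos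
  obtain ⟨χ, hχ⟩ := exists_signChar (G := absoluteGaloisGroup P.F) hi (two_ne_zero' Ω)
  obtain ⟨ρ₃, hρ₃⟩ := exists_galoisRep_GL2_ker_eq P.legendreCurve 3
  obtain ⟨ρ₅, hρ₅⟩ := exists_galoisRep_GL2_ker_eq P.legendreCurve 5
  let Φ : absoluteGaloisGroup P.F →* Multiplicative (ZMod 2) × GL (Fin 2) (ZMod 3) × GL (Fin 2) (ZMod 5) :=
    χ.prod (ρ₃.prod ρ₅)
  -- `F ≃ φ(F) ⊆ Ω`, Galois over `F_tpd`
  let φ : F →ₐ[P.F] Ω := IsAlgClosed.lift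
  set F' : IntermediateField P.F Ω := φ.fieldRange with hF'
  let e : F ≃ₐ[P.F] F' :=
    ((IntermediateField.topEquiv (F := P.F) (E := F)).symm.trans (IntermediateField.equivMap ⊤ φ)).trans
      (IntermediateField.equivOfEq (AlgHom.fieldRange_eq_map φ).symm)
  haveI : IsGalois P.F F' := IsGalois.of_algEquiv e
  -- `ker Φ = Gal(Ω/φ(F))`
  have hker : ∀ σ : absoluteGaloisGroup P.F,
      σ ∈ (F'.fixingSubgroup : Subgroup (absoluteGaloisGroup P.F)) ↔ Φ σ = 1 := by
    intro σ
    have hΦ : Φ σ = 1 ↔ χ σ = 1 ∧ ρ₃ σ = 1 ∧ ρ₅ σ = 1 := by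
      simp only [Φ, MonoidHom.prod_apply, Prod.mk_eq_one]
    rw [hΦ, hχ, ← MonoidHom.mem_ker, ← MonoidHom.mem_ker, hρ₃, hρ₅]
    constructor
    · intro hσ
      refine ⟨?_, fixingSubgroup_fieldRange_le_ker hF φ ⟨5, by norm_num⟩ hσ,
        fixingSubgroup_fieldRange_le_ker hF φ ⟨3, by norm_num⟩ hσ⟩
      exact (IntermediateField.mem_fixingSubgroup_iff _ _).1 hσ i
        (sqrt_neg_one_mem_fieldRange_of_isThetaField hF φ hi)
    · rintro ⟨hσi, h3, h5⟩
      exact mem_fixingSubgroup_fieldRange_of hF φ hi hσi h3 h5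
  -- descend `Φ` along the restriction `Γ → Gal(F'/F_tpd)` (surjective, kernel `Gal(Ω/F')`)
  let r := Literature.NumberTheory.GaloisRepresentations.absRestrictNormalHom F'
  have hr_surj : Function.Surjective r := fun g => by
    obtain ⟨σ, hσ⟩ := AlgEquiv.restrictNormalHom_surjective Ω g
    exact ⟨(absoluteGaloisGroup.toAlgEquiv P.F).symm σ, hσ⟩
  have hr_ker : ∀ σ, r σ = 1 ↔ σ ∈ (F'.fixingSubgroup : Subgroup (absoluteGaloisGroup P.F)) := by
    intro σ
    change AlgEquiv.restrictNormalHom F' (absoluteGaloisGroup.toAlgEquiv P.F σ) = 1 ↔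
      absoluteGaloisGroup.toAlgEquiv P.F σ ∈ F'.fixingSubgroup
    rw [← MonoidHom.mem_ker, IntermediateField.restrictNormalHom_ker]
  have hle : r.ker ≤ Φ.ker := fun σ hσ => by
    rw [MonoidHom.mem_ker] at hσ ⊢
    exact (hker σ).1 ((hr_ker σ).1 hσ)
  let ψ' : (F' ≃ₐ[P.F] F') →* Multiplicative (ZMod 2) × GL (Fin 2) (ZMod 3) × GL (Fin 2) (ZMod 5) :=
    MonoidHom.liftOfSurjective r hr_surj ⟨Φ, hle⟩
  have hψ' : ∀ σ, ψ' (r σ) = Φ σ := fun σ => MonoidHom.liftOfRightInverse_comp_apply _ _ _ _ σ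
  have hψ'_inj : Function.Injective ψ' := by
    rw [injective_iff_map_eq_one]
    intro g hg
    obtain ⟨σ, rfl⟩ := hr_surj g
    rw [hψ'] at hg
    exact (hr_ker σ).2 ((hker σ).2 hg)
  -- carry back to `Gal(F/F_tpd)` along `F ≃ F'`
  exact ⟨ψ'.comp e.autCongr.toMonoidHom, hψ'_inj.comp e.autCongr.injective⟩

/-- **[J-IV] Lemma 4.1.2 DISCHARGED on the theta-field model**: for `λ ∈ U_X` and every theta field `F = F_tpd(√−1, E_λ[3·5])`
of `P` — Joshi's `L = L_tpd(√−1, C_{L_tpd}[3·5])` (§4.1.2 (9)) over `L_tpd = F_tpd` — the claim-`Prop` `GaloisGroupEmbeds L_tpd L`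
HOLDS: `F/F_tpd` is Galois and `Gal(F/F_tpd) ↪ ℤ/2 × GL₂(𝔽₂) × GL₂(𝔽₃) × GL₂(𝔽₅)` (through the factor `ℤ/2 × GL₂(𝔽₃) ×
GL₂(𝔽₅)`). [cite: Mochizuki2012, IUTchIV Thm. 1.10 proof Step (ii) p.24] -/
theorem galoisGroupEmbeds_of_isThetaField (hU : P.InU) (hF : IsThetaField P F) : GaloisGroupEmbeds P.F F := by
  obtain ⟨ψ, hψ⟩ := exists_embedding_galoisGroup_thetaField hU hF
  -- insert the idle factor `GL₂(𝔽₂)`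
  let j : Multiplicative (ZMod 2) × GL (Fin 2) (ZMod 3) × GL (Fin 2) (ZMod 5) →*
      Multiplicative (ZMod 2) × GL (Fin 2) (ZMod 2) × GL (Fin 2) (ZMod 3) × GL (Fin 2) (ZMod 5) :=
    (MonoidHom.fst _ _).prod ((1 : _ →* GL (Fin 2) (ZMod 2)).prod (MonoidHom.snd _ _))
  have hj : Function.Injective j := by
    intro x y h
    have h' : (x.1, (1 : GL (Fin 2) (ZMod 2)), x.2) = (y.1, (1 : GL (Fin 2) (ZMod 2)), y.2) := h
    have h1 := congrArg Prod.fst h'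
    have h2 := congrArg (fun z : Multiplicative (ZMod 2) × GL (Fin 2) (ZMod 2) × GL (Fin 2) (ZMod 3) × GL (Fin 2) (ZMod 5) =>
      z.2.2) h'
    exact Prod.ext h1 h2
  exact ⟨hF.isGalois, j.comp ψ, hj.comp hψ⟩

/-- `#Gal(F/F_tpd) ∣ |ℤ/2 × GL₂(𝔽₃) × GL₂(𝔽₅)| = 46080` (the recorded `IsThetaField.finrank_dvd`, re-derived from the embedding).
[cite: Mochizuki2012, IUTchIV Thm. 1.10 proof Step (ii) p.24] -/
theorem natCard_aut_thetaField_dvd (hU : P.InU) (hF : IsThetaField P F) : Nat.card (F ≃ₐ[P.F] F) ∣ 46080 := by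
  obtain ⟨ψ, hψ⟩ := exists_embedding_galoisGroup_thetaField hU hF
  haveI : Fact (Nat.Prime 3) := ⟨Nat.prime_three⟩
  haveI : Fact (Nat.Prime 5) := ⟨Nat.prime_five⟩
  have h := Subgroup.card_dvd_of_injective ψ hψ
  have hcard : Nat.card (Multiplicative (ZMod 2) × GL (Fin 2) (ZMod 3) × GL (Fin 2) (ZMod 5)) = 46080 := by
    rw [Nat.card_prod, Nat.card_prod, Nat.card_eq_fintype_card (α := Multiplicative (ZMod 2)), Fintype.card_multiplicative,
      ZMod.card, card_GL_two_zmod 3, card_GL_two_zmod 5]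
    norm_num
  rwa [hcard] at h

end ThetaField

end Summit.ABC.IUTFork.Joshi.ATS4
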